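import Literature.Geometry.Riemannian.RicciFlowMaximalExistence
import Literature.Geometry.Riemannian.RicciFlowSpatialRicciBounds
import Literature.Geometry.Riemannian.RicciFlowSingularTimeHolds
import Literature.Geometry.Riemannian.PerelmanNoncollapsingAssembly
import Literature.Geometry.Riemannian.RicciFlowScalarCurvatureHolds
import Literature.Geometry.Riemannian.PerelmanEntropy
import Literature.Geometry.Lorentzian.LeviCivitaProofs
import Literature.Geometry.Lorentzian.CurvatureRegularity
import HarnessLib

/-!
# The singular Ricci flow with Perelman's floor, modulo short-time existence and (T2)

Stub `stub_singularFlow` of line `ancient-sphere-rigidity` for the crux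
`EntropyRung.SubcylindricalRecognition` (stmt-SmoothPoincare4-10869), proved CONDITIONALLY on the
two named facts it genuinely needs:

* (F1) `Literature.Geometry.Riemannian.ricciFlow_shortTime_existence` (Hamilton 1982, Thm. 4.2;
  Topping 2006, Thm. 5.2.1) — undischarged in the tree; it yields the maximal solution
  (`ricciFlow_maximal_existence_of_shortTime_existence`, Hamilton 1982, Thm. 14.1) and the
  curvature blow-up at a finite singular time (`ricciFlow_curvature_blowup_of_shortTime`,
  Topping 2006, Thm. 5.3.1);
* (F2) `Literature.Geometry.Riemannian.perelman_muEntropy_monotone` — Perelman's monotonicity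
  (T2) of `μ` along the Ricci flow on a closed manifold, `μ(g(0), τ + T') ≤ μ(g(T'), τ)`
  (Perelman 2002, §3.1, (3.4); Topping 2006, (8.3.10)), with exactly the shape of hypothesis
  `h₂` of `perelman_noLocalCollapsing_of_muMonotone` / `exists_isKappaNoncollapsed_of_muMonotone`
  — undischarged; the tree proves it modulo the backward solvability of the conjugate heat
  equation (`muEntropy_le_muEntropy_of_conjugateHeat`).

## What

`stub_singularFlow_of (hST) (hT2)`: for a Riemannian metric `g₀` with `R > 0` on a closed
connected `4`-manifold whose `𝒲`-entropy satisfies the unfolded floor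
`𝒲(g₀, f, τ) ≥ ν_cyl + δ` for all `τ > 0` and all smooth compatible `f`
(`ν_cyl = log 2 + (log π)/2 − 3/2`), there are `T`, `κ > 0` and a maximal Ricci flow `(g, cov)`
on `[0, T)` with `g 0 = g₀`, whose curvature blows up as `t ↑ T`, which is `κ`-noncollapsed on
every scale `< √T`, and with `μ(g(t), τ) ≥ ν_cyl + δ` for all `t ∈ [0, T)`, `τ > 0`.

## Proof

* `R_min > 0`: `g₀.scalarCurvature` is smooth (`PseudoRiemannianMetric.contMDiff_scalarCurvature`,
  O'Neill 1983, Def. 3.53), `M` is compact and nonempty (connected);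
* the all-time alternative of `ricciFlow_maximal_existence` is excluded by Topping's Cor. 3.2.4
  (`IsRicciFlow.singularTime_le`, proved in the tree): `T ≤ 4/(2 R_min)` for every `T`;
  the scalar curvature of the pair `(g 0, cov 0)` is that of `g₀` because any Levi-Civita
  connection of `g₀` has the Ricci tensor of `g₀` (`IsLeviCivita.ricci_eq_ricci`);
* blow-up: `ricciFlow_curvature_blowup_of_shortTime`;
* (T2) for the maximal flow restricted to `[0, t₀]`, `0 < t₀ < T`, feeds
  `exists_isKappaNoncollapsed_of_muMonotone` (Perelman 2002, Thm. 4.1; Topping 2006, Thm. 8.3.1,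
  proved in the tree modulo (T2)) — this is the `κ`;
* the floor: the unfolded clause is `(ν_cyl + δ : EReal) ≤ μ(g₀, cov₀, τ)` for every Levi-Civita
  witness `cov₀` of `g₀` (dictionary `coe_le_muEntropy_iff_integral`: `le_muEntropy_iff`,
  `riemVolume_eq`, `entropyDensity_apply`, `finrank_euclideanSpace_fin`, `ricci_eq_ricci`), and it
  propagates by (T2): `μ(g(t), τ) ≥ μ(g(0), τ + t) ≥ ν_cyl + δ`.

## Design

The named fact (F2) lives in `Literature/Geometry/Riemannian/PerelmanEntropyMonotonicity.lean`
(proposal p72219, imported through `PerelmanNoncollapsingAssembly`). Universe levels of both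
facts are pinned to `0` in the consumer, matching the registered stub (`M : Type`, model
`EuclideanSpace ℝ (Fin 4)`). The unconditional registered stub `stub_singularFlow` is NOT proved
here (that would require discharging (F1) and (F2)); the skeleton consumes `stub_singularFlow_of`.

## References

* [ONeill1983] B. O'Neill, *Semi-Riemannian geometry*, Academic Press 1983, Ch. 3, Thm. 3.11,
  Def. 3.53.
* [Hamilton1982] R. S. Hamilton, *Three-manifolds with positive Ricci curvature*, J. Differential
  Geom. 17 (1982), Thm. 4.2, Thm. 14.1.
* [Perelman2002] G. Perelman, *The entropy formula for the Ricci flow and its geometric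
  applications*, arXiv:math/0211159, §3.1 (3.4), §4 Thm. 4.1.
* [Topping2006] P. Topping, *Lectures on the Ricci flow*, LMS LNS 325, CUP 2006, Cor. 3.2.4,
  Thm. 5.2.1, Thm. 5.3.1, §8.1, (8.3.10), Thm. 8.3.1.
-/

noncomputable section

open scoped Manifold ContDiff Topology ENNReal NNReal ContinuousMap
open Set MeasureTheory Module
open Literature.Geometry.Lorentzian Literature.Geometry.Riemannian

namespace Summit.SmoothPoincare4.SmoothPoincare4.Theorems.SubcylindricalRecognition.AncientSphereRigidity

/-! ### Dictionary: the unfolded entropy floor is a lower bound for `μ` -/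

/-- Perelman's density in dimension `4`, unfolded: `u = (4πτ)^{-4/2} e^{-f}`.
[cite: Topping2006, §8.1, (8.1.1)] -/
theorem entropyDensity_four {M : Type*} (f : M → ℝ) (τ : ℝ) (x : M) :
    entropyDensity 4 f τ x = (4 * Real.pi * τ) ^ (-(4 : ℝ) / 2) * Real.exp (-f x) := by
  rw [entropyDensity_apply]
  norm_num

section Dictionary

variable {M : Type*} [TopologicalSpace M] [ChartedSpace (EuclideanSpace ℝ (Fin 4)) M]
  [IsManifold (𝓡 4) ∞ M]

/-- **The scalar curvature of `(g, cov)` is that of `g`** for every Levi-Civita witness `cov`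
of the smooth metric `g` (O'Neill 1983, Ch. 3, Thm. 3.11 and Def. 3.53): any torsion-free
`g`-compatible connection has the Ricci tensor of `g` (`IsLeviCivita.ricci_eq_ricci`).
[cite: ONeill1983, Ch. 3, Def. 3.53] -/
theorem scalarCurvatureWith_eq_scalarCurvature
    (g : PseudoRiemannianMetric (𝓡 4) ∞ (EuclideanSpace ℝ (Fin 4))
      (TangentSpace (𝓡 4) : M → Type _)) [g.HasLeviCivita]
    {cov : CovariantDerivative (𝓡 4) (EuclideanSpace ℝ (Fin 4)) (TangentSpace (𝓡 4) : M → Type _)}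
    (hLC : g.IsLeviCivita cov) (x : M) :
    g.scalarCurvatureWith cov x = g.scalarCurvature x := by
  have h2 : (2 : ℕ∞ω) ≤ (∞ : ℕ∞ω) := WithTop.coe_le_coe.2 le_top
  rw [PseudoRiemannianMetric.scalarCurvatureWith, hLC.ricci_eq_ricci h2 x]
  rfl

variable [T3Space M] [MeasurableSpace M] [BorelSpace M]

/-- **Dictionary** between the crux's unfolded entropy floor and Perelman's `μ`
(Perelman 2002, §3.1; Topping 2006, §8.1, (8.1.6)): for a Riemannian metric `g` on a
`4`-manifold, a Levi-Civita witness `cov` of `g` and reals `c`, `τ`,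
`(c : EReal) ≤ μ(g, cov, τ)` iff `c ≤ ∫ [τ(R + |∇f|²) + f − 4] (4πτ)^{-2} e^{-f} dV` for every
smooth `f` with `∫ (4πτ)^{-2} e^{-f} dV = 1`, `dV` the Riemannian measure of `g` and `R` the
scalar curvature of `g` (`le_muEntropy_iff`, `riemVolume_eq`, `entropyDensity_apply`,
`finrank_euclideanSpace_fin`, `scalarCurvatureWith_eq_scalarCurvature`).
[cite: Perelman2002, §3.1, definition of μ] -/
theorem coe_le_muEntropy_iff_integral
    (g : PseudoRiemannianMetric (𝓡 4) ∞ (EuclideanSpace ℝ (Fin 4))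
      (TangentSpace (𝓡 4) : M → Type _)) [g.HasLeviCivita] (hg : g.IsRiemannian)
    {cov : CovariantDerivative (𝓡 4) (EuclideanSpace ℝ (Fin 4)) (TangentSpace (𝓡 4) : M → Type _)}
    (hLC : g.IsLeviCivita cov) (c τ : ℝ) :
    ((c : ℝ) : EReal) ≤ g.muEntropy cov τ ↔
      ∀ f : M → ℝ, ContMDiff (𝓡 4) 𝓘(ℝ, ℝ) ∞ f →
        ∫ x, (4 * Real.pi * τ) ^ (-(4 : ℝ) / 2) * Real.exp (-f x)
          ∂(riemannianMeasure (g.toContMDiffRiemannianMetric hg)) = 1 →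
        c ≤ ∫ x, (τ * (g.scalarCurvature x + g.gradSq f x) + f x - 4) *
            ((4 * Real.pi * τ) ^ (-(4 : ℝ) / 2) * Real.exp (-f x))
            ∂(riemannianMeasure (g.toContMDiffRiemannianMetric hg)) := by
  have hW : ∀ f : M → ℝ, g.wEntropy cov f τ =
      ∫ x, (τ * (g.scalarCurvature x + g.gradSq f x) + f x - 4) *
        ((4 * Real.pi * τ) ^ (-(4 : ℝ) / 2) * Real.exp (-f x))
        ∂(riemannianMeasure (g.toContMDiffRiemannianMetric hg)) := fun f ↦ by
    rw [PseudoRiemannianMetric.wEntropy_def, PseudoRiemannianMetric.riemVolume_eq hg]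
    simp only [finrank_euclideanSpace_fin, entropyDensity_four,
      scalarCurvatureWith_eq_scalarCurvature g hLC, Nat.cast_ofNat]
  rw [PseudoRiemannianMetric.le_muEntropy_iff]
  refine forall₂_congr fun f _ ↦ ?_
  rw [PseudoRiemannianMetric.isEntropyCompatible_iff, PseudoRiemannianMetric.riemVolume_eq hg,
    hW, EReal.coe_le_coe_iff]
  simp only [finrank_euclideanSpace_fin, entropyDensity_four]

/-- The dictionary at the Levi-Civita connection `g.leviCivita` of `g` (the spelling of the
crux's revision 0): `(c : EReal) ≤ μ(g, ∇^g, τ)` iff the unfolded floor with constant `c` holds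
at scale `τ`. [cite: Perelman2002, §3.1, definition of μ] -/
theorem coe_le_muEntropy_leviCivita_iff_integral
    (g : PseudoRiemannianMetric (𝓡 4) ∞ (EuclideanSpace ℝ (Fin 4))
      (TangentSpace (𝓡 4) : M → Type _)) [g.HasLeviCivita] (hg : g.IsRiemannian) (c τ : ℝ) :
    ((c : ℝ) : EReal) ≤ g.muEntropy g.leviCivita τ ↔
      ∀ f : M → ℝ, ContMDiff (𝓡 4) 𝓘(ℝ, ℝ) ∞ f →
        ∫ x, (4 * Real.pi * τ) ^ (-(4 : ℝ) / 2) * Real.exp (-f x)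
          ∂(riemannianMeasure (g.toContMDiffRiemannianMetric hg)) = 1 →
        c ≤ ∫ x, (τ * (g.scalarCurvature x + g.gradSq f x) + f x - 4) *
            ((4 * Real.pi * τ) ^ (-(4 : ℝ) / 2) * Real.exp (-f x))
            ∂(riemannianMeasure (g.toContMDiffRiemannianMetric hg)) :=
  coe_le_muEntropy_iff_integral g hg
    (PseudoRiemannianMetric.isLeviCivita_leviCivita_holds (g := g)) c τ

end Dictionary

/-! ### The conditional stub -/

/-- **The singular Ricci flow with Perelman's floor** (stub `stub_singularFlow` of line
`ancient-sphere-rigidity`, crux `EntropyRung.SubcylindricalRecognition`), CONDITIONAL on the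
named facts `ricciFlow_shortTime_existence` (Hamilton 1982, Thm. 4.2) and
`perelman_muEntropy_monotone` (Perelman 2002, (3.4); Topping 2006, (8.3.10)). For a Riemannian
metric `g₀` with `R > 0` on a closed connected `4`-manifold satisfying the unfolded entropy floor
`𝒲(g₀, f, τ) ≥ ν_cyl + δ` (`τ > 0`, `f` smooth and compatible), there are `T`, `κ > 0` and a
maximal Ricci flow `(g, cov)` on `[0, T)` from `g₀` (Hamilton 1982, Thm. 14.1; finite `T` by
Topping 2006, Cor. 3.2.4) with curvature blow-up (Topping 2006, Thm. 5.3.1), `κ`-noncollapsed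
below `√T` (Perelman 2002, Thm. 4.1; Topping 2006, Thm. 8.3.1) and with
`μ(g(t), τ) ≥ ν_cyl + δ` on `[0, T)` (monotonicity (T2)).
[cite: Perelman2002, §4, Thm. 4.1] -/
theorem stub_singularFlow_of :
    ricciFlow_shortTime_existence.{0, 0, 0} → perelman_muEntropy_monotone.{0, 0, 0} →
    ∀ (M : Type) [TopologicalSpace M] [T2Space M] [SecondCountableTopology M]
      [ChartedSpace (EuclideanSpace ℝ (Fin 4)) M] [IsManifold (𝓡 4) ∞ M] [CompactSpace M]
      [ConnectedSpace M] [T3Space M] [MeasurableSpace M] [BorelSpace M]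
      (g₀ : PseudoRiemannianMetric (𝓡 4) ∞ (EuclideanSpace ℝ (Fin 4))
        (TangentSpace (𝓡 4) : M → Type _))
      [g₀.HasLeviCivita] (hg₀ : g₀.IsRiemannian),
      (∀ x : M, 0 < g₀.scalarCurvature x) →
      ∀ δ : ℝ, 0 < δ →
      (∀ τ : ℝ, 0 < τ → ∀ f : M → ℝ, ContMDiff (𝓡 4) 𝓘(ℝ, ℝ) ∞ f →
        ∫ x, (4 * Real.pi * τ) ^ (-(4 : ℝ) / 2) * Real.exp (-f x)
          ∂(riemannianMeasure (g₀.toContMDiffRiemannianMetric hg₀)) = 1 →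
        Real.log 2 + Real.log Real.pi / 2 - 3 / 2 + δ ≤
          ∫ x, (τ * (g₀.scalarCurvature x + g₀.gradSq f x) + f x - 4) *
            ((4 * Real.pi * τ) ^ (-(4 : ℝ) / 2) * Real.exp (-f x))
            ∂(riemannianMeasure (g₀.toContMDiffRiemannianMetric hg₀))) →
      ∃ (T κ : ℝ), 0 < κ ∧
        ∃ (g : ℝ → PseudoRiemannianMetric (𝓡 4) ∞ (EuclideanSpace ℝ (Fin 4))
            (TangentSpace (𝓡 4) : M → Type _))
          (cov : ℝ → CovariantDerivative (𝓡 4) (EuclideanSpace ℝ (Fin 4))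
            (TangentSpace (𝓡 4) : M → Type _)),
          IsMaximalRicciFlow g cov T ∧ g 0 = g₀ ∧
          (∀ C : ℝ, ∃ t₀ ∈ Set.Ico 0 T, ∀ t ∈ Set.Ico t₀ T, ¬ CurvatureBoundedBy (g t) (cov t) C) ∧
          (∀ r₀ : ℝ, 0 < r₀ → r₀ < Real.sqrt T → IsKappaNoncollapsed g cov (Set.Ico 0 T) κ r₀) ∧
          (∀ t ∈ Set.Ico 0 T, ∀ τ : ℝ, 0 < τ →
            ((Real.log 2 + Real.log Real.pi / 2 - 3 / 2 + δ : ℝ) : EReal) ≤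
              (g t).muEntropy (cov t) τ) := by
  intro hST hT2 M _ _ _ _ _ _ _ _ _ _ g₀ _ hg₀ hR δ _hδ hfloor
  -- the floor in `μ`-form, for every Levi-Civita witness of `g₀`
  have hμ₀ : ∀ cov₀ : CovariantDerivative (𝓡 4) (EuclideanSpace ℝ (Fin 4))
      (TangentSpace (𝓡 4) : M → Type _), g₀.IsLeviCivita cov₀ → ∀ τ : ℝ, 0 < τ →
      ((Real.log 2 + Real.log Real.pi / 2 - 3 / 2 + δ : ℝ) : EReal) ≤ g₀.muEntropy cov₀ τ :=
    fun cov₀ hLC τ hτ ↦ (coe_le_muEntropy_iff_integral g₀ hg₀ hLC _ τ).2 (hfloor τ hτ)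
  -- (1) a positive lower bound for the scalar curvature (compactness, `M ≠ ∅`)
  have hcont : Continuous g₀.scalarCurvature :=
    (PseudoRiemannianMetric.contMDiff_scalarCurvature g₀).continuous
  obtain ⟨x₀, -, hx₀⟩ := isCompact_univ.exists_isMinOn univ_nonempty hcont.continuousOn
  have hα : 0 < g₀.scalarCurvature x₀ := hR x₀
  have hαR : ∀ x, g₀.scalarCurvature x₀ ≤ g₀.scalarCurvature x := fun x ↦ hx₀ (mem_univ x)
  -- (2) the maximal solution; the all-time alternative contradicts Cor. 3.2.4
  rcases ricciFlow_maximal_existence_of_shortTime_existence hST (𝓡 4) M g₀ hg₀ with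
    ⟨g, cov, hflow, hRiem, h0⟩ | ⟨T, hT, g, cov, hmax, h0⟩
  · exfalso
    have hLC : g₀.IsLeviCivita (cov 0) := by
      have h := hflow.isLeviCivita 0 (by simp)
      rwa [h0] at h
    have h0' : ∀ x, g₀.scalarCurvature x₀ ≤ (g 0).scalarCurvatureWith (cov 0) x := fun x ↦ by
      rw [h0, scalarCurvatureWith_eq_scalarCurvature g₀ hLC x]
      exact hαR x
    have key := IsRicciFlow.singularTime_le (T := 4 / (2 * g₀.scalarCurvature x₀) + 1)
      (hflow.mono Ico_subset_Ici_self) (by positivity) (fun t ht ↦ hRiem t ht.1) hα h0'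
    rw [finrank_euclideanSpace_fin] at key
    push_cast at key
    linarith
  -- the maximal case
  have hflow : IsRicciFlow g cov (Ico 0 T) := hmax.isRicciFlow
  have hRiem : ∀ t ∈ Ico 0 T, (g t).IsRiemannian := hmax.isRiemannian
  -- (3) curvature blow-up (Topping 2006, Thm. 5.3.1, from short-time existence)
  have hblow := ricciFlow_curvature_blowup_of_shortTime hST (𝓡 4) M T g cov hmax
  -- (4) (T2) for the flow restricted to `[0, t₀]`, `0 < t₀ < T`
  have hmono : ∀ t₀ ∈ Ioo 0 T, ∀ τ : ℝ, 0 < τ →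
      (g 0).muEntropy (cov 0) (τ + t₀) ≤ (g t₀).muEntropy (cov t₀) τ := fun t₀ ht₀ τ hτ ↦
    hT2 (𝓡 4) M t₀ ht₀.1 g cov (hflow.mono (Icc_subset_Ico_right ht₀.2))
      (fun t ht ↦ hRiem t ⟨ht.1, ht.2.trans_lt ht₀.2⟩) τ hτ
  -- (5) no local collapsing (Perelman 2002, Thm. 4.1)
  obtain ⟨κ, hκ, hnc⟩ := exists_isKappaNoncollapsed_of_muMonotone hT g cov hflow hRiem hmono
  -- (6) the floor along the flow
  have hLC0 : g₀.IsLeviCivita (cov 0) := by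
    have h := hflow.isLeviCivita 0 hmax.zero_mem
    rwa [h0] at h
  have hfl : ∀ t ∈ Ico 0 T, ∀ τ : ℝ, 0 < τ →
      ((Real.log 2 + Real.log Real.pi / 2 - 3 / 2 + δ : ℝ) : EReal) ≤
        (g t).muEntropy (cov t) τ := by
    intro t ht τ hτ
    rcases ht.1.eq_or_lt with rfl | ht0
    · rw [h0]
      exact hμ₀ (cov 0) hLC0 τ hτ
    · calc ((Real.log 2 + Real.log Real.pi / 2 - 3 / 2 + δ : ℝ) : EReal)
          ≤ (g 0).muEntropy (cov 0) (τ + t) := by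
            rw [h0]
            exact hμ₀ (cov 0) hLC0 (τ + t) (by positivity)
        _ ≤ (g t).muEntropy (cov t) τ := hmono t ⟨ht0, ht.2⟩ τ hτ
  exact ⟨T, κ, hκ, g, cov, hmax, h0, hblow, hnc, hfl⟩

end Summit.SmoothPoincare4.SmoothPoincare4.Theorems.SubcylindricalRecognition.AncientSphereRigidity

end
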